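import Summits.MatrixMultiplication.MatrixMultiplication.Theses.FidelityWitnesses
import Literature.Computability.AlgebraicComplexity.SmallFormatRank
import Literature.Computability.AlgebraicComplexity.MatMulRankLowerBoundsBlaserProofs
import Literature.Computability.AlgebraicComplexity.BorderRankMatMulTwoHolds
import Literature.Computability.AlgebraicComplexity.BorderRankMatMulThreeWindow
import Literature.Computability.AlgebraicComplexity.MatMulRankLowerBoundsProofs
import Literature.Computability.AlgebraicComplexity.FlatteningBound

/-!
# Disproof of `LinearDefectLaw` — findings (cdisprove seat, crux stmt-MatrixMultiplication-14039)

Crux (route `FidelityWitnesses`, rank 2):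
`∀ n r S, tensorRank S ≤ r → ‖Σ S·⟨n,n,n⟩‖² ≤ (n³ + r − R̲(⟨n,n,n⟩))·Σ‖S‖²`,
i.e. `M(n,r) := sup_{R(S) ≤ r} |⟨S,T⟩|²/‖S‖² ≤ n³ − (R̲ − r)`, i.e. `dist(⟨n,n,n⟩, σ̂_r)² ≥ R̲ − r`
(`R̲` = the tree's `algBorderRank` over `ℂ`).  Elaborates (rc 0); the subtraction is real, no ℕ-junk;
`n = 0, 1` hold trivially; no degenerate instance is false.

CYCLE 2 (refuter-cdisprove-…-14039-g2-0, 2026-08-16) — still NOT refuted; what is new: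
* § G GENERAL KILL SWITCH (kernel-checked; landed as p83140 `…Theorems.LinearDefectLaw.Negative.KillSwitch`,
  review-queued): for ANY `n`, any certified `L ≤ R̲(⟨n,n,n⟩)` and any integer tensor of rank `≤ r`,
  `(n³ + r − L)·‖S‖² < ⟨S,T⟩²` refutes the crux (`not_linearDefectLaw_of_int_lb`); and the crux READ AS
  AN ECKART–YOUNG–MIRSKY UPPER BOUND: law ⇒ `R̲(⟨n,n,n⟩) ≤ r + dist(⟨n,n,n⟩, ℂ·S)²` for every `S ≠ 0` of
  rank `≤ r` (`borderRank_le_of_linearDefectLaw`) — so at `n = 3` the law is double-edged: an approximant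
  with `r + d² < 20` would beat Smirnov under the law, `< 17` would contradict CHL.
* § H THE HORIZON AT `n = 3` (tree: `16 ≤ R̲(⟨3,3,3⟩) ≤ 20`, `LandsbergMichalek_sixteen_le…`,
  `Smirnov2013_…_le`): unconditionally the law says only `M(3,r) ≤ r + 11` (`lawThree_of_linearDefectLaw`),
  VACUOUS on the whole window `16 ≤ r ≤ 19`; kill shapes `> r + 11` (uncond.), `> r + 10` (mod CHL),
  `> r + 7` (mod `SmirnovTight : R̲ = 20`, i.e. `r + d_r < 20`).  Measured: `r + d_r ≥ 21.33` everywhere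
  (`d₁₆ ≤ 6.03, d₁₇ ≤ 5.01, d₁₈ ≤ 4.00, d₁₉ ≤ 2.33, d₂₀ = 0`, triage k1 kit j012293), largest fidelity
  excess `M(3,r) − r = 5.67` (needs `> 11`).  Caveat both ways: Tichavský–Phan–Cichocki 2016
  (arXiv:1603.01372, p. 6) could not even reach Smirnov's 20 numerically ("conjecture … border rank 21"),
  so unseeded `n = 3` numerics neither threaten nor support the law; Smirnov-SEEDED ones (§ L) show the
  first deletion is free (`R̲(⟨3,3,3⟩ − e) ≤ 20`) and the step `20 → 19` costs `≈ 2`.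
* § I STRASSEN'S EQUATIONS SEE THE (2,5) RUNG EXACTLY (kit j013638, done): with
  `V := {X ∈ ℂ⁴⊗ℂ⁴⊗ℂ⁴ : rank K_ℓ(X) ≤ 10 for every line ℓ in each of the three slots (12×12 p = 1
  Koszul = Strassen commutator test) and rank K_full(X) ≤ 15}` `⊇ σ̂₅`, the distance
  `dist(⟨2,2,2⟩, V)² = 1.999998 ≈ 2 = d₅²` (45/45 starts after adversarial line completion; any 21 fixed
  generic lines leave a spurious hole at `1.5058`; the full 24×16 flattenings alone give only `1.0000`,
  minimiser `T − e`).  The `V`-minimiser found is NOT Bini's deletion: `X* = T − D*`, `‖D*‖² = 2`,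
  fidelity `6.000002`, DECODED: `D* = (P⊗1⊗1)·W₂` where `T = W₁ + W₂`, `W_j = Σ_{ik} c_ik⊗a_ij⊗b_jk`
  (the `j`-th rank-one-update block `≅ I₄`) and `P` a Hermitian rank-2 PROJECTION on the output space
  (`tr P = ‖P‖² = 2 = ⟨D*,T⟩ = ‖D*‖²` from the digits) onto a NON-coordinate 2-plane; so
  `X* = W₁ + (I−P)W₂`, `(I−P)W₂` of `2×2×2` format (border rank 2), `X*` of honest rank 6 (rank-6 ALS
  exact) with rank-5 floor `0.335` — Bini's `M^red` is the member of this Grassmannian family with `im P`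
  = a row/column of `C` (a ruling 2-plane of `C ≅ Mat₂`), the only type that drops to border rank 5.
  Hence `V ⊋ σ̂₅` near the sphere `‖T − X‖² = 2`, but `dist(T,V) = dist(T,σ̂₅)`: `V` sees the
  DISTANCE, not the minimisers (replicated with another random line set, kit j013999: hole `1.772` →
  `2.0000` after completion, minimiser of the same type).
  READING for provers: `SixEighthsAtFive` would follow from Strassen's degree-11 minors plus an exact
  distance computation on the determinantal variety `V` — a far more algebraic target than `σ̂₅`; for the
  disprover: the (2,5) rung is rigid even on `V`, nothing is gained by tensors that merely pass every
  Strassen test.  FORMALLY (§ I′, kernel-checked): `StrassenMetricTwoFive → SixEighthsAtFive`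
  (`sixEighthsAtFive_of_strassenMetricTwoFive`, via the tree's Landsberg–Ottaviani rank bound and
  `tensorRank_rotate`), `StrassenMetricTwoFive` = the metric statement on the determinantal variety,
  stated with the tree's `koszulFlattening 1 Φ` over all `Φ : ℂ⁴ →ₗ ℂ³` in the three slots.
* § J ORDER-`h` BORDER CHARTS at (2,5), `h = 0…3` (the attack surface left open by cycle 1; kit
  j014350): Bini's chart point is CRITICAL in every chart (`h = 1,2,3`, projected gradient 0; constraint
  Jacobian ranks 52/128, 86/256, 126/384 — very singular); Riemannian ascent from 37 Bini-perturbed + 18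
  random feasible chart points never exceeds `6` (best `5.944/5.944/5.930` for `h = 1/2/3`, honest
  re-evaluation agrees); honest ascent `≤ 5.99942` (22 random) and `5.99939 ↗ 5.99942` from the DIAGONAL
  deletion (§ M′).  0 alerts.
* § M′ SECOND TIGHT ORBIT (kit j014009): `⟨2,2,2⟩ − a₁₁b₁₁c₁₁ − a₂₂b₂₂c₂₂` has border rank 5 numerically
  (rank-5 ALS error `3.3·10⁻⁴ ↘`, same signature as `M^red`) and fidelity exactly `6` (`diagDelZ_vals`,
  `decide`); its `A`-marginal has rank 2 (Bini's: 1) ⇒ a different `K`-orbit of maximisers; the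
  "share-one-index" 2-deletions stay at distance² `0.75` from `σ̂₅` (border rank 6).
* § M PENCIL-FLATNESS (kit j014009): `dist(T + (u−1)e, σ̂₅)² = min(1+|u|², 2)` for all 15 `u` tested
  (incl. complex) ⇒ `M₅ = 6` on the whole circle `|u| = 1`; the bound is not special to `u = 1`.
* § K TWO FAMILIES THAT CAN NEVER TEST THE LAW (paper): (i) deletions `S = T|_K` (refuter g48: the law
  at a deletion reads `R̲(T) ≤ R(T|_K) + (n³ − |K|)`, subadditivity) — the law is TIGHT exactly there;
  (ii) NEW: Cohn–Umans pull-backs with collisions — `S(a,b,c) = [α(a)β(b) = γ(c)]` for maps into an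
  ABELIAN group `G` (`R(S) ≤ |G|` by characters, `S ⊇ T`): the number of solutions is `Σ_g m(g)² ≥ n⁶/|G|`
  (`m(g) = #{(i,j,k) : −s_i + t_j + u_k = g}`, Cauchy–Schwarz), so fidelity `n⁶/#sol ≤ |G|` and
  `|G| + d² ≥ n³`: such `S` are ADDITIVE (no super-additivity), they never enter the contentful regime.
  Kills need genuinely analog approximants with fidelity excess `> n³ − L(n)` (`> 1` at `n = 2`, `> 11` at
  `n = 3`); the only analog excesses known are `0.006` (2,3), `0.414` (2,4), `1` (2,5 border, 2,6),
  `≈ 5.7` (3,19).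
* § L THE `n = 3` WINDOW (kit j013639, j014363, j014532): the first deletion is FREE —
  Smirnov-seeded ALS gives `R̲(⟨3,3,3⟩ − e) ≤ 20 = R̲(⟨3,3,3⟩)` numerically for 26/27 products, and no
  sign of 19 (floor `1.02`) — so the `n = 2` pattern `R̲(T − e) = R̲(T) − 1` FAILS at `n = 3` and the
  step `20 → 19` costs `≈ 2`; nearest points `d₁₉ ≤ 2.012`, `d₁₈ ≤ 3.021`, `d₁₇ ≤ 5.001`,
  `d₁₆ ≤ 6.03` (the "21-staircase" `d_r ≈ 21 − r` at `r = 18, 19`, then `d₂₀ = 0`): `r + d_r ≥ 21.01`,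
  slack `1.0` against the law modulo `SmirnovTight` (was `1.33`); LM-polished sweeps over all Smirnov
  drop-one/drop-two seeds = kit j014518 (auto-attached; rank 19 best `2.007`).

STATUS (cycle 1): NOT refuted.  Where a kill can live, and why it has not been found:

* The only instances decidable in Lean today are `n = 2` (tree: `algBorderRank_matMulTensor_two`,
  `R̲(⟨2,2,2⟩) = 7`, sorry-free): the law reads `M(2,r) ≤ r + 1` (`LawTwo r` below,
  `lawTwo_of_linearDefectLaw`).  At `n = 3` the tree knows only `15 ≤ R̲(⟨3,3,3⟩)`
  (`fifteen_le_algBorderRank_matMulTensor_three`; CHL's `17` is a named fact), so an unconditional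
  kill needs `M(3,r) > r + 12` and a kill modulo `ConnerHarperLandsberg2023_thm_1_1` needs
  `M(3,r) > r + 10` — both far beyond every number measured (`M(3,r) − r ≲ 1` for `r ≤ 9`, planner).
* `n = 2`, rung by rung (numerics: this seat's pure-python complex ALS, 1 350 runs, folder `num/`;
  planner/SevenEighthsLaw-disprover campaigns agree): `M(2,3) = 3.005815 < 4`, `M(2,4) = 4.414135
  (≈ 3+√2) < 5`, `M(2,5) → 6⁻ = 6` (TIGHT, border: Bini), `M(2,6) = 7.000000 = 7` (TIGHT, honest:
  `⟨2,2,2⟩ − e`).  800 runs at `r = 5` (random / sub-support / Bini border seeds with noise up to the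
  factor scale) never exceed `6`: best `5.99998`, always from BELOW along Bini's valley.
* WHY (2,5) RESISTS — the border point is critical and second-order stable (new, this file's main
  finding; pen-and-paper + exact linear algebra + float optimisation, scripts `jobs/jet2.py`,
  `jobs/phi_blocks.py`):
  Let `S₀ = M^red = ⟨2,2,2⟩ − E`, `E = x²₂⊗(y²₁⊗z¹₂ + y²₂⊗z²₂)` (Landsberg's indexing), `f(S₀) = 36/6
  = 6`.  Exactly: `f(S₀ + P) > 6 ⟺ 12·Re⟨P,E⟩ + |⟨P,T⟩|² > 6‖P‖²`.  Grade `A = A₀ ⊕ A₁`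
  (`A₀ = ⟨x¹₂,x²₁⟩`, `A₁ = ⟨x¹₁,x²₂⟩`), `B₀ = ⟨y¹₁,y¹₂⟩`, `C₀ = ⟨z¹₁,z²₁⟩`: then `T = S₀ + E` with `S₀`
  of degree 1 and `E` of degree 3, and Bini's base configuration `C₀` (five rank-one tensors summing
  to 0) lies in `A₀⊗B₀⊗C₀`.  (i) Every zero-sum 5-configuration near `C₀` is a `GL₄³`-image of one
  inside the block (dimension count on relation spaces), so every polynomial rank-5 scheme near the
  valley is a scheme over the FIXED base `C₀` with factors `a_l + t a'_l + t² a''_l + …`.  (ii) First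
  order: `T₂ ⟂ E` for every such scheme (each 2-jet term keeps a base leg) — `S₀` is critical; the
  26-dim linear space `𝕋(C₀) = Σ_l T̂_{p_l}Seg ⊂ σ̂₅` through `S₀` is `⟂ E` (rank of the map `L`
  computed exactly: 26, `dim ker L = 34`).  (iii) Second order: with `T₁ = S₀`, `f(S(t)) > 6` for
  some small complex `t` iff `g := 2|κ| − ‖Π_{𝕋(C₀)^⟂} B(a',b',c')‖² > 0`, `κ = ⟨Σ_l a'_l⊗b'_l⊗c'_l, E⟩`,
  `B = Σ_l (a'_l b'_l c_l + a'_l b_l c'_l + a_l b'_l c'_l)`, over the affine space `{L(a',b',c') = S₀}`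
  (34 complex dims).  Hill-climbing from 40 random starts at scales `10⁻²…10^{0.5}`: `sup g = −3/2`
  (every run ends at `−1.5000`, e.g. `|κ| = 134.51`, loss `270.52`; Bini's own point has `g = −4`).
  So `S₀` is a strict local maximum of the fidelity on `σ̂₅` at the 2-jet level: `f ≤ 6 − (3/2)|t|²·c`.
  (iv) Globally over first-order border limits: every `h = 1` limit over a non-degenerate zero-sum
  5-configuration lies in `𝔽(A₀',B₀',C₀') = A⊗B₀'⊗C₀' + A₀'⊗B⊗C₀' + A₀'⊗B₀'⊗C` for some 2-planes, and
  `Φ := ‖proj_𝔽 ⟨2,2,2⟩‖² = Σ_{Y,Z}‖YZ‖² + Σ_{X,Z}‖Q_B (ZX)^*‖² + Σ_{X,Y}‖Q_C (XY)^*‖²` has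
  `max_{Gr(2,4)³} Φ = 6.000000000` (120 restarts, global and local; Bini's block attains it; proved by
  hand on the slice `B₀' = B₀, C₀' = C₀`: `Φ = 2 + 2Σ_X(|X₁₂|²+|X₂₁|²) ≤ 6`); degenerate
  configurations ("cross tensors" `M⊗b⊗· + a⊗N`) give `Φ = 4 − ‖ab‖² ≤ 4`.  NOT covered: `h ≥ 2` border
  schemes and a proof of `Φ ≤ 6`; these are the remaining attack surface at (2,5).
* (2,6): `T − e` is an honest critical point (value 7 attained); > 800 descent runs of the
  SevenEighthsLaw disprover + 300 here: no second critical value.  A kill of `SevenEighthsLaw` kills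
  this crux too (`linearDefectLaw_implies`).

What this file PROVES (kernel-checked, no `sorry`):
* § Transfer — integer witnesses suffice (`not_linearDefectLaw_of_int`: an integer tensor of rank
  `≤ r` with `(r+1)·‖S‖² < ⟨S,T⟩²` refutes the crux); `LinearDefectLaw → SixEighthsAtFive ∧
  SevenEighthsLaw` (`linearDefectLaw_implies`): the law's decidable content is exactly the two open
  n = 2 rungs.
* § (a) LOAD-BEARING — the rank hypothesis is everything: without it `S = T`, `r = 0` gives `64 ≤ 8`
  (`false_without_rank`).  (Replacing `R̲` by the rank `R(⟨n,n,n⟩)` changes nothing at `n = 2`.)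
* § (b) TIGHTNESS — (2,6): equality `49 = 7·7` ATTAINED by the honest rank-6 integer tensor
  `⟨2,2,2⟩ − a₂₂⊗b₂₂⊗c₂₂` (`tight_two_six`, Strassen transported; data as in the SevenEighthsLaw
  Disproof).  (2,5): the bound `6` is the limit of the honest rank-5 Bini family
  `bini5S m = m·M^red + C₂` (`overlapZ = 6m`, `normSqZ = 6m² + 4`, ratio `6 − 24/(6m²+4) ↑ 6`,
  `tight_two_five`), approached from BELOW (`bini5S_ratio_lt_six`), limit point `M^red` of ratio
  exactly `6` but rank 6 (`MredZ_vals`).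
* § (c) NATURAL STRENGTHENINGS REFUTED — (c1) any uniform extra slack `δ > 0` in the law
  (`not_linearDefectLaw_slack`); (c2) additivity at rank 5, `M(2,5) ≤ 5` (`not_additive_at_five`:
  `144 > 140` at `m = 2`); (c3) `M(2,5) ≤ 6 − 1/100` (`not_lawTwo_five_strengthened`).
* § (d) Targets: none registered yet (payload.targets empty).
* § (e) Near-misses: none claimable; see the WHY paragraph — the live attack surface is `h ≥ 2` border
  schemes at (2,5) and a certificate/refutation of `Φ ≤ 6`.
-/

set_option linter.dupNamespace false

namespace Summit.MatrixMultiplication.MatrixMultiplication.Cruxes.LinearDefectLaw.Disproof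

open Literature.Computability.AlgebraicComplexity
open Summit.MatrixMultiplication.MatrixMultiplication.Theses.FidelityWitnesses
  (LinearDefectLaw SixEighthsAtFive SevenEighthsLaw)

/-- index type of one tensor slot of `⟨2,2,2⟩` -/
abbrev P2 := Fin 2 × Fin 2

/-! ## The decidable instances: `n = 2`, where the tree knows `R̲(⟨2,2,2⟩) = 7` -/

/-- The `(2, r)` instance of the law with `R̲(⟨2,2,2⟩) = 7` substituted: `M(2,r) ≤ r + 1`. -/
def LawTwo (r : ℕ) : Prop :=
  ∀ S : P2 → P2 → P2 → ℂ, tensorRank S ≤ r →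
    ‖∑ a, ∑ b, ∑ c, S a b c * matMulTensor ℂ 2 2 2 a b c‖ ^ 2 ≤
      ((r : ℝ) + 1) * ∑ a, ∑ b, ∑ c, ‖S a b c‖ ^ 2

/-- `LinearDefectLaw` specialises at `n = 2` to `M(2,r) ≤ r + 1` (uses the tree theorem
`algBorderRank_matMulTensor_two : R̲(⟨2,2,2⟩) = 7`). -/
theorem lawTwo_of_linearDefectLaw (h : LinearDefectLaw) (r : ℕ) : LawTwo r := by
  intro S hS
  have key := h 2 r S hS
  rw [algBorderRank_matMulTensor_two ℂ] at key
  have e : ((2 : ℕ) : ℝ) ^ 3 + (r : ℝ) - ((7 : ℕ) : ℝ) = (r : ℝ) + 1 := by push_cast; ring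
  rw [e] at key
  exact key

/-- `LawTwo 5` is literally the support item `SixEighthsAtFive`. -/
theorem lawTwo_five_iff : LawTwo 5 ↔ SixEighthsAtFive := by
  unfold LawTwo SixEighthsAtFive
  norm_num

/-- `LawTwo 6` is literally the crux `SevenEighthsLaw`. -/
theorem lawTwo_six_iff : LawTwo 6 ↔ SevenEighthsLaw := by
  unfold LawTwo SevenEighthsLaw
  norm_num

/-- The law implies both open `n = 2` rungs of the route; a kill of either kills the law. -/
theorem linearDefectLaw_implies (h : LinearDefectLaw) : SixEighthsAtFive ∧ SevenEighthsLaw :=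
  ⟨lawTwo_five_iff.1 (lawTwo_of_linearDefectLaw h 5), lawTwo_six_iff.1 (lawTwo_of_linearDefectLaw h 6)⟩

/-! ## Transfer: integer witnesses -/

/-- an integer tensor viewed over `ℂ` -/
def castT (Sz : P2 → P2 → P2 → ℤ) : P2 → P2 → P2 → ℂ := fun a b c => (Sz a b c : ℂ)

/-- overlap `⟨S, ⟨2,2,2⟩⟩` over `ℤ` -/
def overlapZ (Sz : P2 → P2 → P2 → ℤ) : ℤ := ∑ a, ∑ b, ∑ c, Sz a b c * matMulTensor ℤ 2 2 2 a b c

/-- squared norm over `ℤ` -/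
def normSqZ (Sz : P2 → P2 → P2 → ℤ) : ℤ := ∑ a, ∑ b, ∑ c, Sz a b c ^ 2

theorem overlap_castT (Sz : P2 → P2 → P2 → ℤ) :
    (∑ a, ∑ b, ∑ c, castT Sz a b c * matMulTensor ℂ 2 2 2 a b c) = (overlapZ Sz : ℂ) := by
  unfold overlapZ castT
  push_cast
  refine Finset.sum_congr rfl fun a _ => Finset.sum_congr rfl fun b _ =>
    Finset.sum_congr rfl fun c _ => ?_
  congr 1
  unfold matMulTensor
  split_ifs <;> simp

theorem normSq_castT (Sz : P2 → P2 → P2 → ℤ) :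
    (∑ a, ∑ b, ∑ c, ‖castT Sz a b c‖ ^ 2) = ((normSqZ Sz : ℤ) : ℝ) := by
  unfold normSqZ castT
  push_cast
  refine Finset.sum_congr rfl fun a _ => Finset.sum_congr rfl fun b _ =>
    Finset.sum_congr rfl fun c _ => ?_
  rw [Complex.norm_intCast, sq_abs]

theorem tensorRank_castT_le (Sz : P2 → P2 → P2 → ℤ) : tensorRank (castT Sz) ≤ tensorRank Sz :=
  tensorRank_map_le (Int.castRingHom ℂ) Sz

/-- The squared overlap and norm of an integer tensor, read over `ℂ`/`ℝ`. -/
theorem ratio_castT (Sz : P2 → P2 → P2 → ℤ) :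
    ‖∑ a, ∑ b, ∑ c, castT Sz a b c * matMulTensor ℂ 2 2 2 a b c‖ ^ 2 = ((overlapZ Sz ^ 2 : ℤ) : ℝ)
    ∧ (∑ a, ∑ b, ∑ c, ‖castT Sz a b c‖ ^ 2) = ((normSqZ Sz : ℤ) : ℝ) := by
  refine ⟨?_, normSq_castT Sz⟩
  rw [overlap_castT, Complex.norm_intCast, sq_abs]
  push_cast
  rfl

/-- **Transfer.** An integer tensor of rank `≤ r` with `q·‖S‖² < ⟨S,T⟩²` is a complex witness of
ratio `> q` at rank `r`. -/
theorem violates_of_int (Sz : P2 → P2 → P2 → ℤ) (r : ℕ) (q : ℤ) (hr : tensorRank Sz ≤ r)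
    (h : q * normSqZ Sz < overlapZ Sz ^ 2) :
    ∃ S : P2 → P2 → P2 → ℂ, tensorRank S ≤ r ∧
      (q : ℝ) * ∑ a, ∑ b, ∑ c, ‖S a b c‖ ^ 2 <
        ‖∑ a, ∑ b, ∑ c, S a b c * matMulTensor ℂ 2 2 2 a b c‖ ^ 2 := by
  refine ⟨castT Sz, (tensorRank_castT_le Sz).trans hr, ?_⟩
  rw [(ratio_castT Sz).1, (ratio_castT Sz).2]
  exact_mod_cast h

/-- **The shape of a kill at `n = 2`:** an integer tensor of rank `≤ r` with
`(r+1)·‖S‖² < ⟨S,⟨2,2,2⟩⟩²` refutes `LinearDefectLaw` (homogeneity ⇒ integer/Gaussian data suffice). -/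
theorem not_linearDefectLaw_of_int (r : ℕ) (Sz : P2 → P2 → P2 → ℤ) (hr : tensorRank Sz ≤ r)
    (h : ((r : ℤ) + 1) * normSqZ Sz < overlapZ Sz ^ 2) : ¬ LinearDefectLaw := by
  intro hlaw
  obtain ⟨S, hS, hlt⟩ := violates_of_int Sz r ((r : ℤ) + 1) hr h
  have key := lawTwo_of_linearDefectLaw hlaw r S hS
  push_cast at hlt
  exact absurd key (not_le.mpr hlt)

/-! ## (a) Load-bearing analysis: the rank hypothesis is the whole content -/

/-- `LinearDefectLaw` with the hypothesis `tensorRank S ≤ r` dropped. -/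
def LinearDefectLawWithoutRank : Prop :=
  ∀ n r : ℕ, ∀ S : Fin n × Fin n → Fin n × Fin n → Fin n × Fin n → ℂ,
    ‖∑ a, ∑ b, ∑ c, S a b c * matMulTensor ℂ n n n a b c‖ ^ 2 ≤
      ((n : ℝ) ^ 3 + (r : ℝ) - (algBorderRank (matMulTensor ℂ n n n) : ℝ)) *
        ∑ a, ∑ b, ∑ c, ‖S a b c‖ ^ 2

theorem overlapZ_matMul : overlapZ (matMulTensor ℤ 2 2 2) = 8 := by decide
theorem normSqZ_matMul : normSqZ (matMulTensor ℤ 2 2 2) = 8 := by decide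

theorem castT_matMul : castT (matMulTensor ℤ 2 2 2) = matMulTensor ℂ 2 2 2 := by
  funext a b c
  unfold castT matMulTensor
  split_ifs <;> simp

/-- **(a) Any proof must use the rank bound**: without it, `n = 2`, `r = 0`, `S = ⟨2,2,2⟩` reads
`64 ≤ (8 + 0 − 7)·8`. -/
theorem false_without_rank : ¬ LinearDefectLawWithoutRank := by
  intro h
  have key := h 2 0 (castT (matMulTensor ℤ 2 2 2))
  rw [(ratio_castT _).1, (ratio_castT _).2, overlapZ_matMul, normSqZ_matMul,
    algBorderRank_matMulTensor_two ℂ] at key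
  norm_num at key

/-! ## (b) Tightness at `(2,6)`: equality attained by an honest integer rank-6 tensor -/

/-- A vector on `P2` from its four values at `(0,0), (0,1), (1,0), (1,1)`. [folklore] -/
def vec4 (v00 v01 v10 v11 : ℤ) : P2 → ℤ := fun p => ![![v00, v01], ![v10, v11]] p.1 p.2

/-- Z-slot factors of Strassen's algorithm transported by the isotropy element
`(g,h,k) = ([[1,0],[1,1]], [[0,1],[1,0]], [[1,1],[0,1]])` (product `M₆ ↦ a₂₂⊗b₂₂⊗c₂₂`); the six
other products (data as in `Cruxes/SevenEighthsLaw/Disproof.lean`). [cite: Strassen1969] -/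
def sixW : Fin 6 → P2 → ℤ :=
  ![vec4 1 1 (-1) 0, vec4 0 0 1 0, vec4 0 1 0 0, vec4 1 1 0 0, vec4 (-1) 0 1 0, vec4 1 1 (-1) (-1)]

/-- X-slot factors of the six transported Strassen products. [cite: Strassen1969] -/
def sixU : Fin 6 → P2 → ℤ :=
  ![vec4 1 1 1 0, vec4 1 1 1 1, vec4 0 1 0 0, vec4 1 0 1 0, vec4 1 1 0 0, vec4 0 0 (-1) 0]

/-- Y-slot factors of the six transported Strassen products. [cite: Strassen1969] -/
def sixV : Fin 6 → P2 → ℤ :=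
  ![vec4 (-1) 1 1 0, vec4 0 0 1 0, vec4 1 (-1) (-1) 1, vec4 1 0 (-1) 0, vec4 (-1) 1 0 0, vec4 0 1 0 0]

/-- `sixS = Σ_{r<6} sixW r ⊗ sixU r ⊗ sixV r`. [cite: Strassen1969] -/
def sixS : P2 → P2 → P2 → ℤ := fun a b c => ∑ r, sixW r a * sixU r b * sixV r c

/-- `sixS = ⟨2,2,2⟩ − a₂₂⊗b₂₂⊗c₂₂` (all 64 entries, `decide`). [cite: Strassen1969] -/
theorem sixS_eq : sixS = fun a b c =>
    matMulTensor ℤ 2 2 2 a b c - (if a = (1, 1) ∧ b = (1, 1) ∧ c = (1, 1) then 1 else 0) := by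
  decide

theorem tensorRank_sixS_le : tensorRank sixS ≤ 6 :=
  tensorRank_le_of_eq_sum sixW sixU sixV (by funext a b c; simp [sixS, Finset.sum_apply, triad_apply])

theorem sixS_vals : overlapZ sixS = 7 ∧ normSqZ sixS = 7 := by decide

/-- **(b) `(2,6)` is TIGHT and ATTAINED**: the honest rank-6 tensor `⟨2,2,2⟩ − a₂₂⊗b₂₂⊗c₂₂` has
`‖S‖² = 7` and `|⟨S,T⟩|² = 49 = (6 + 1)·‖S‖²` — equality in `LawTwo 6`. [cite: Strassen1969] -/
theorem tight_two_six : ∃ S : P2 → P2 → P2 → ℂ, tensorRank S ≤ 6 ∧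
    (∑ a, ∑ b, ∑ c, ‖S a b c‖ ^ 2) = 7 ∧
    ‖∑ a, ∑ b, ∑ c, S a b c * matMulTensor ℂ 2 2 2 a b c‖ ^ 2 =
      ((6 : ℝ) + 1) * ∑ a, ∑ b, ∑ c, ‖S a b c‖ ^ 2 := by
  refine ⟨castT sixS, (tensorRank_castT_le _).trans tensorRank_sixS_le, ?_, ?_⟩
  · rw [(ratio_castT _).2, sixS_vals.2]; push_cast; ring
  · rw [(ratio_castT _).1, (ratio_castT _).2, sixS_vals.1, sixS_vals.2]; push_cast; norm_num

/-! ## (b) Tightness at `(2,5)` on the border: the honest rank-5 Bini family `m·M^red + C₂` -/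

/-- indicator of position `(i, j)` on `P2`, over `ℤ` -/
def e (i j : Fin 2) : P2 → ℤ := fun p => if p = (i, j) then 1 else 0

/-- Z-slot factors (output side, `c_{ki} ↦ position (i,k)`) of Bini's five products at `ε = 1/m`,
cleared of denominators (Landsberg 2017, (2.1.2)). [cite: Landsberg2017, (2.1.2)] -/
def bini5W (m : ℤ) : Fin 5 → P2 → ℤ :=
  ![e 0 1, m • e 0 0 + e 1 0, m • e 0 0 + m • e 0 1 + e 1 1, e 0 0, m • e 0 0 + e 1 1]

/-- X-slot factors (`a_{ij}`): `(m a₁₂ + a₁₁), (m a₂₁ + a₁₁), −m a₁₂, −m a₂₁, a₁₂ + a₂₁`.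
[cite: Landsberg2017, (2.1.2)] -/
def bini5U (m : ℤ) : Fin 5 → P2 → ℤ :=
  ![m • e 0 1 + e 0 0, m • e 1 0 + e 0 0, -(m • e 0 1), -(m • e 1 0), e 0 1 + e 1 0]

/-- Y-slot factors (`b_{jk}`): `(m b₁₂ + b₂₂), b₁₁, b₁₂, (m b₁₁ + m b₁₂ + b₂₁), (m b₁₂ + b₂₁)`.
[cite: Landsberg2017, (2.1.2)] -/
def bini5V (m : ℤ) : Fin 5 → P2 → ℤ :=
  ![m • e 0 1 + e 1 1, e 0 0, e 0 1, m • e 0 0 + m • e 0 1 + e 1 0, m • e 0 1 + e 1 0]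

/-- `bini5S m = Σ_{r<5} bini5W m r ⊗ bini5U m r ⊗ bini5V m r = m·M^red + C₂`: an HONEST rank-`≤ 5`
integer tensor for every `m` (`M^red = ⟨2,2,2⟩` without its two `a₂₂`-products, `C₂ ⟂ ⟨2,2,2⟩`,
`‖C₂‖² = 4`). [cite: Landsberg2017, (2.1.2)] -/
def bini5S (m : ℤ) : P2 → P2 → P2 → ℤ := fun a b c => ∑ r, bini5W m r a * bini5U m r b * bini5V m r c

theorem tensorRank_bini5S_le (m : ℤ) : tensorRank (bini5S m) ≤ 5 :=
  tensorRank_le_of_eq_sum (bini5W m) (bini5U m) (bini5V m)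
    (by funext a b c; simp [bini5S, Finset.sum_apply, triad_apply])

theorem overlapZ_bini5S (m : ℤ) : overlapZ (bini5S m) = 6 * m := by
  simp [overlapZ, bini5S, bini5W, bini5U, bini5V, e, matMulTensor, Fintype.sum_prod_type,
    Fin.sum_univ_succ]
  ring

theorem normSqZ_bini5S (m : ℤ) : normSqZ (bini5S m) = 6 * m ^ 2 + 4 := by
  simp [normSqZ, bini5S, bini5W, bini5U, bini5V, e, Fintype.sum_prod_type, Fin.sum_univ_succ]
  ring

/-- The Bini family approaches the bound `6` strictly from BELOW: `(6m)² < 6·(6m² + 4)`. -/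
theorem bini5S_ratio_lt_six (m : ℤ) : overlapZ (bini5S m) ^ 2 < 6 * normSqZ (bini5S m) := by
  rw [overlapZ_bini5S, normSqZ_bini5S]; nlinarith [sq_nonneg m]

/-- The family in the crux's own terms: honest rank `≤ 5`, overlap² `36m²`, norm² `6m² + 4`. -/
theorem bini5S_family (m : ℤ) : ∃ S : P2 → P2 → P2 → ℂ, tensorRank S ≤ 5 ∧
    ‖∑ a, ∑ b, ∑ c, S a b c * matMulTensor ℂ 2 2 2 a b c‖ ^ 2 = (6 * m) ^ 2 ∧
    (∑ a, ∑ b, ∑ c, ‖S a b c‖ ^ 2) = 6 * m ^ 2 + 4 := by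
  refine ⟨castT (bini5S m), (tensorRank_castT_le _).trans (tensorRank_bini5S_le m), ?_, ?_⟩
  · rw [(ratio_castT _).1, overlapZ_bini5S]; push_cast; ring
  · rw [(ratio_castT _).2, normSqZ_bini5S]; push_cast; ring

/-- **(b) `(2,5)` is TIGHT**: the constant `6 = 5 + 1` of `LawTwo 5` cannot be lowered — for every
`η > 0` some honest rank-`≤ 5` tensor has `(6 − η)·‖S‖² < |⟨S,T⟩|²` (ratio `6 − 24/(6m² + 4)`). -/
theorem tight_two_five (η : ℝ) (hη : 0 < η) : ∃ S : P2 → P2 → P2 → ℂ, tensorRank S ≤ 5 ∧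
    (6 - η) * ∑ a, ∑ b, ∑ c, ‖S a b c‖ ^ 2 <
      ‖∑ a, ∑ b, ∑ c, S a b c * matMulTensor ℂ 2 2 2 a b c‖ ^ 2 := by
  obtain ⟨m, hm⟩ := exists_nat_gt (24 / η)
  obtain ⟨S, hS, h1, h2⟩ := bini5S_family (m : ℤ)
  refine ⟨S, hS, ?_⟩
  rw [h1, h2]
  push_cast
  have hm0 : (0 : ℝ) ≤ m := Nat.cast_nonneg m
  have h24 : 24 < η * m := by rwa [div_lt_iff₀ hη, mul_comm] at hm
  nlinarith [mul_nonneg hm0 hm0, sq_nonneg ((m : ℝ)), h24, hη]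

/-- The border limit point `M^red = ⟨2,2,2⟩ ∖ {a₂₂ b₂₁, a₂₂ b₂₂}` (Bini's tensor; border rank 5,
rank 6), as an integer tensor in the tree's slot order `(Z, X, Y)`. [cite: Landsberg2017, §2.1.4] -/
def MredZ : P2 → P2 → P2 → ℤ := fun a b c =>
  if b = (1, 1) then 0 else matMulTensor ℤ 2 2 2 a b c

/-- `⟨M^red, T⟩ = ‖M^red‖² = 6`: ratio exactly `6 = 5 + 1`, the bound of `LawTwo 5`, on the border. -/
theorem MredZ_vals : overlapZ MredZ = 6 ∧ normSqZ MredZ = 6 := by decide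

/-- `bini5S m = m·M^red + C₂` with `C₂ = bini5S 0` (`= x¹₁y²₂z²₁ + x¹₁y¹₁z¹₂ + (x¹₂+x²₁)y²₁z²₂`,
orthogonal to `⟨2,2,2⟩`): the family is the secant of Bini's valley. [cite: Landsberg2017, (2.1.2)] -/
theorem bini5S_eq (m : ℤ) : bini5S m = fun a b c => m * MredZ a b c + bini5S 0 a b c := by
  funext a b c
  obtain ⟨a1, a2⟩ := a
  obtain ⟨b1, b2⟩ := b
  obtain ⟨c1, c2⟩ := c
  fin_cases a1 <;> fin_cases a2 <;> fin_cases b1 <;> fin_cases b2 <;> fin_cases c1 <;>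
    fin_cases c2 <;>
    simp [bini5S, bini5W, bini5U, bini5V, e, MredZ, matMulTensor, Fin.sum_univ_succ]

theorem C2_vals : overlapZ (bini5S 0) = 0 ∧ normSqZ (bini5S 0) = 4 := by decide

/-! ## (c) Natural strengthenings refuted -/

/-- (c1) **No uniform extra slack**: for every `δ > 0` the strengthened law
`|⟨S,T⟩|² ≤ (n³ + r − R̲ − δ)·‖S‖²` is false — at `(n,r) = (2,6)` the honest tensor
`⟨2,2,2⟩ − a₂₂ b₂₂ c₂₂` has `49 > (7 − δ)·7`. -/
theorem not_linearDefectLaw_slack (δ : ℝ) (hδ : 0 < δ) :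
    ¬ ∀ n r : ℕ, ∀ S : Fin n × Fin n → Fin n × Fin n → Fin n × Fin n → ℂ, tensorRank S ≤ r →
      ‖∑ a, ∑ b, ∑ c, S a b c * matMulTensor ℂ n n n a b c‖ ^ 2 ≤
        ((n : ℝ) ^ 3 + (r : ℝ) - (algBorderRank (matMulTensor ℂ n n n) : ℝ) - δ) *
          ∑ a, ∑ b, ∑ c, ‖S a b c‖ ^ 2 := by
  intro h
  have key := h 2 6 (castT sixS) ((tensorRank_castT_le _).trans tensorRank_sixS_le)
  rw [(ratio_castT _).1, (ratio_castT _).2, sixS_vals.1, sixS_vals.2,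
    algBorderRank_matMulTensor_two ℂ] at key
  norm_num at key
  linarith

/-- (c2) **Fidelity is NOT additive at rank 5**: `M(2,5) ≤ 5` ("five multiplications capture at most
five of the eight units") fails — `bini5S 2` (honest rank `≤ 5`) has `⟨S,T⟩² = 144 > 140 = 5·‖S‖²`. -/
theorem not_additive_at_five :
    ¬ ∀ S : P2 → P2 → P2 → ℂ, tensorRank S ≤ 5 →
      ‖∑ a, ∑ b, ∑ c, S a b c * matMulTensor ℂ 2 2 2 a b c‖ ^ 2 ≤
        5 * ∑ a, ∑ b, ∑ c, ‖S a b c‖ ^ 2 := by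
  intro h
  have key := h (castT (bini5S 2)) ((tensorRank_castT_le _).trans (tensorRank_bini5S_le 2))
  rw [(ratio_castT _).1, (ratio_castT _).2, overlapZ_bini5S, normSqZ_bini5S] at key
  norm_num at key

/-- (c3) The strengthening `M(2,5) ≤ 6 − 1/100` of `SixEighthsAtFive`/`LawTwo 5` is FALSE. -/
theorem not_lawTwo_five_strengthened : ¬ (∀ S : P2 → P2 → P2 → ℂ, tensorRank S ≤ 5 →
    ‖∑ a, ∑ b, ∑ c, S a b c * matMulTensor ℂ 2 2 2 a b c‖ ^ 2 ≤
      (6 - 1 / 100) * ∑ a, ∑ b, ∑ c, ‖S a b c‖ ^ 2) := by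
  intro h
  obtain ⟨S, hS, hlt⟩ := tight_two_five (1 / 100) (by norm_num)
  exact absurd (h S hS) (not_le.mpr hlt)

/-! ## (d) Targets

No line has been picked and no stub is registered for this crux yet (payload.targets = []). -/

/-! ## (e) Near-misses / open

No claimable near-miss.  The live attack surface (module docstring): `h ≥ 2` border schemes of
`σ̂₅` near `M^red`, and the block bound `Φ ≤ 6` (numerically exact, unproved).  The 2-jet supremum
`sup g = −3/2 < 0` says every first-order-chart curve through `M^red` has fidelity
`≤ 6 − c|t|²`: the provers' certificate at (2,5) must be second-order tight along a 34-dimensional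
family and exactly tight only in the limit `t → 0`. -/

/-! ## Cycle 2 — § G. The general kill switch (every `n`, every certified `L ≤ R̲(⟨n,n,n⟩)`) -/

/-- index type of one slot of `⟨n,n,n⟩` -/
abbrev Pn (n : ℕ) := Fin n × Fin n

/-- an integer tensor of format `⟨n,n,n⟩` viewed over `ℂ` -/
def castTn {n : ℕ} (Sz : Pn n → Pn n → Pn n → ℤ) : Pn n → Pn n → Pn n → ℂ :=
  fun a b c => (Sz a b c : ℂ)

/-- overlap `⟨S, ⟨n,n,n⟩⟩` over `ℤ` -/
def overlapZn {n : ℕ} (Sz : Pn n → Pn n → Pn n → ℤ) : ℤ :=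
  ∑ a, ∑ b, ∑ c, Sz a b c * matMulTensor ℤ n n n a b c

/-- squared norm over `ℤ` -/
def normSqZn {n : ℕ} (Sz : Pn n → Pn n → Pn n → ℤ) : ℤ := ∑ a, ∑ b, ∑ c, Sz a b c ^ 2

theorem normSqZn_nonneg {n : ℕ} (Sz : Pn n → Pn n → Pn n → ℤ) : 0 ≤ normSqZn Sz :=
  Finset.sum_nonneg fun _ _ => Finset.sum_nonneg fun _ _ => Finset.sum_nonneg fun _ _ => sq_nonneg _

theorem overlap_castTn {n : ℕ} (Sz : Pn n → Pn n → Pn n → ℤ) :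
    (∑ a, ∑ b, ∑ c, castTn Sz a b c * matMulTensor ℂ n n n a b c) = (overlapZn Sz : ℂ) := by
  unfold overlapZn castTn
  push_cast
  refine Finset.sum_congr rfl fun a _ => Finset.sum_congr rfl fun b _ =>
    Finset.sum_congr rfl fun c _ => ?_
  congr 1
  unfold matMulTensor
  split_ifs <;> simp

theorem normSq_castTn {n : ℕ} (Sz : Pn n → Pn n → Pn n → ℤ) :
    (∑ a, ∑ b, ∑ c, ‖castTn Sz a b c‖ ^ 2) = ((normSqZn Sz : ℤ) : ℝ) := by
  unfold normSqZn castTn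
  push_cast
  refine Finset.sum_congr rfl fun a _ => Finset.sum_congr rfl fun b _ =>
    Finset.sum_congr rfl fun c _ => ?_
  rw [Complex.norm_intCast, sq_abs]

theorem tensorRank_castTn_le {n : ℕ} (Sz : Pn n → Pn n → Pn n → ℤ) :
    tensorRank (castTn Sz) ≤ tensorRank Sz :=
  tensorRank_map_le (Int.castRingHom ℂ) Sz

theorem ratio_castTn {n : ℕ} (Sz : Pn n → Pn n → Pn n → ℤ) :
    ‖∑ a, ∑ b, ∑ c, castTn Sz a b c * matMulTensor ℂ n n n a b c‖ ^ 2 = ((overlapZn Sz ^ 2 : ℤ) : ℝ)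
    ∧ (∑ a, ∑ b, ∑ c, ‖castTn Sz a b c‖ ^ 2) = ((normSqZn Sz : ℤ) : ℝ) := by
  refine ⟨?_, normSq_castTn Sz⟩
  rw [overlap_castTn, Complex.norm_intCast, sq_abs]
  push_cast
  rfl

/-- **§ G. The general kill switch.** For ANY `n`, any CERTIFIED lower bound `L ≤ R̲(⟨n,n,n⟩)` and any
integer tensor `S` with an integer rank-`≤ r` certificate, the decidable inequality
`(n³ + r − L)·‖S‖² < ⟨S,⟨n,n,n⟩⟩²` refutes `LinearDefectLaw` (base change `ℤ → ℂ`, monotonicity in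
the border-rank slot).  The law is falsifiable at `n` exactly to the extent that `L` is close to the
truth: the witness must capture MORE than `n³ − (L − r)` of the `n³` units with `r` products. -/
theorem not_linearDefectLaw_of_int_lb (n r L : ℕ) (hL : L ≤ algBorderRank (matMulTensor ℂ n n n))
    (Sz : Pn n → Pn n → Pn n → ℤ) (hr : tensorRank Sz ≤ r)
    (h : ((n : ℤ) ^ 3 + r - L) * normSqZn Sz < overlapZn Sz ^ 2) : ¬ LinearDefectLaw := by
  intro hlaw
  have key := hlaw n r (castTn Sz) ((tensorRank_castTn_le Sz).trans hr)
  rw [(ratio_castTn Sz).1, (ratio_castTn Sz).2] at key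
  have hL' : (L : ℝ) ≤ (algBorderRank (matMulTensor ℂ n n n) : ℝ) := by exact_mod_cast hL
  have hN : (0 : ℝ) ≤ ((normSqZn Sz : ℤ) : ℝ) := by exact_mod_cast normSqZn_nonneg Sz
  have h' : ((((n : ℤ) ^ 3 + r - L) * normSqZn Sz : ℤ) : ℝ) < ((overlapZn Sz ^ 2 : ℤ) : ℝ) := by
    exact_mod_cast h
  push_cast at key h'
  nlinarith [mul_le_mul_of_nonneg_right hL' hN]

/-- **The law read as a border-rank UPPER bound** ("Eckart–Young–Mirsky for `⟨n,n,n⟩`"): under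
`LinearDefectLaw`, EVERY tensor `S ≠ 0` of rank `≤ r` certifies
`R̲(⟨n,n,n⟩) ≤ r + (n³ − |⟨S,T⟩|²/‖S‖²) = r + dist(⟨n,n,n⟩, ℂ·S)²`.  So a numerical approximant with
`r + d_r(S) < 20` at `n = 3` would, under the law, beat Smirnov's `R̲(⟨3,3,3⟩) ≤ 20`, and one with
`r + d_r(S) < 17` would contradict CHL 2023: the law is double-edged at `n = 3`. -/
theorem borderRank_le_of_linearDefectLaw (hlaw : LinearDefectLaw) (n r : ℕ)
    (S : Pn n → Pn n → Pn n → ℂ) (hS : tensorRank S ≤ r) (hS0 : 0 < ∑ a, ∑ b, ∑ c, ‖S a b c‖ ^ 2) :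
    (algBorderRank (matMulTensor ℂ n n n) : ℝ) ≤
      (r : ℝ) + ((n : ℝ) ^ 3 - ‖∑ a, ∑ b, ∑ c, S a b c * matMulTensor ℂ n n n a b c‖ ^ 2 /
        ∑ a, ∑ b, ∑ c, ‖S a b c‖ ^ 2) := by
  have key := hlaw n r S hS
  rw [← sub_nonneg]
  have e : (r : ℝ) + ((n : ℝ) ^ 3 - ‖∑ a, ∑ b, ∑ c, S a b c * matMulTensor ℂ n n n a b c‖ ^ 2 /
        ∑ a, ∑ b, ∑ c, ‖S a b c‖ ^ 2) - (algBorderRank (matMulTensor ℂ n n n) : ℝ) =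
      (((n : ℝ) ^ 3 + (r : ℝ) - (algBorderRank (matMulTensor ℂ n n n) : ℝ)) *
          (∑ a, ∑ b, ∑ c, ‖S a b c‖ ^ 2) -
        ‖∑ a, ∑ b, ∑ c, S a b c * matMulTensor ℂ n n n a b c‖ ^ 2) /
        ∑ a, ∑ b, ∑ c, ‖S a b c‖ ^ 2 := by
    field_simp
    ring
  rw [e]
  exact div_nonneg (sub_nonneg.mpr key) hS0.le

/-! ## Cycle 2 — § H. The falsifiability horizon at `n = 3` (tree: `16 ≤ R̲(⟨3,3,3⟩) ≤ 20`) -/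

/-- At `n = 3` the law asserts at most `M(3,r) ≤ r + 11` unconditionally (tree:
`LandsbergMichalek_sixteen_le_algBorderRank_matMulTensor_three`), i.e. `d_r ≥ 16 − r`: VACUOUS for
`r ≥ 16`, which is the whole window `16 ≤ r ≤ 19` where the non-trivial approximants live
(numerics: `r + d_r ≥ 21.33` at every point found, `d₁₆ ≤ 6.03, d₁₇ ≤ 5.01, d₁₈ ≤ 4.00, d₁₉ ≤ 2.33,
d₂₀ = 0`, kit j012293 / j013560). -/
theorem lawThree_of_linearDefectLaw (hlaw : LinearDefectLaw) (r : ℕ) (S : Pn 3 → Pn 3 → Pn 3 → ℂ)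
    (hS : tensorRank S ≤ r) :
    ‖∑ a, ∑ b, ∑ c, S a b c * matMulTensor ℂ 3 3 3 a b c‖ ^ 2 ≤
      ((r : ℝ) + 11) * ∑ a, ∑ b, ∑ c, ‖S a b c‖ ^ 2 := by
  have key := hlaw 3 r S hS
  have h16 : (16 : ℝ) ≤ (algBorderRank (matMulTensor ℂ 3 3 3) : ℝ) := by
    exact_mod_cast LandsbergMichalek_sixteen_le_algBorderRank_matMulTensor_three ℂ
  have hN : (0 : ℝ) ≤ ∑ a, ∑ b, ∑ c, ‖S a b c‖ ^ 2 := by positivity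
  push_cast at key
  nlinarith [mul_le_mul_of_nonneg_right h16 hN]

/-- **Unconditional kill shape at `n = 3`:** an integer tensor of rank `≤ r` with
`(r + 11)·‖S‖² < ⟨S,⟨3,3,3⟩⟩²` (so necessarily `r ≤ 15` and fidelity `> r + 11`, against the measured
`M(3,r) − r ≲ 1` for `r ≤ 9` and `≲ 5.7` for `r ≤ 19`). -/
theorem not_linearDefectLaw_of_int_three (r : ℕ) (Sz : Pn 3 → Pn 3 → Pn 3 → ℤ)
    (hr : tensorRank Sz ≤ r) (h : ((r : ℤ) + 11) * normSqZn Sz < overlapZn Sz ^ 2) :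
    ¬ LinearDefectLaw :=
  not_linearDefectLaw_of_int_lb 3 r 16 (LandsbergMichalek_sixteen_le_algBorderRank_matMulTensor_three ℂ)
    Sz hr (by push_cast; linarith)

/-- **Kill shape at `n = 3` modulo CHL 2023** (`17 ≤ R̲(⟨3,3,3⟩)`, a named fact of the tree):
fidelity `> r + 10` at rank `r`. -/
theorem not_linearDefectLaw_of_int_three_CHL (hCHL : ConnerHarperLandsberg2023_thm_1_1) (r : ℕ)
    (Sz : Pn 3 → Pn 3 → Pn 3 → ℤ) (hr : tensorRank Sz ≤ r)
    (h : ((r : ℤ) + 10) * normSqZn Sz < overlapZn Sz ^ 2) : ¬ LinearDefectLaw :=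
  not_linearDefectLaw_of_int_lb 3 r 17 hCHL Sz hr (by push_cast; linarith)

/-- `R̲(⟨3,3,3⟩) = 20` ("Smirnov is optimal") — the hypothesis under which the law is STRONGEST at
`n = 3` (`d_r ≥ 20 − r`: `d₁₉ ≥ 1`, `d₁₈ ≥ 2`, …, tight along unit deletions iff
`R̲(⟨3,3,3⟩ − k·e) = 20 − k`, the `n = 3` analogue of Bini/Strassen at `n = 2`).  An open problem,
not constructible in the tree; recorded as the `H` of a would-be negative lemma. -/
def SmirnovTight : Prop := algBorderRank (matMulTensor ℂ 3 3 3) = 20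

/-- **Kill shape at `n = 3` modulo `SmirnovTight`:** fidelity `> r + 7` at rank `r`, i.e.
`r + d_r < 20` — a 19-term approximant with `d² < 1`, an 18-term one with `d² < 2`, … (best found:
`19 + 2.33`, `18 + 4.00`, `17 + 5.01`, `16 + 6.03`, `20 + 0`). -/
theorem not_linearDefectLaw_of_int_three_smirnovTight (h20 : SmirnovTight) (r : ℕ)
    (Sz : Pn 3 → Pn 3 → Pn 3 → ℤ) (hr : tensorRank Sz ≤ r)
    (h : ((r : ℤ) + 7) * normSqZn Sz < overlapZn Sz ^ 2) : ¬ LinearDefectLaw :=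
  not_linearDefectLaw_of_int_lb 3 r 20 (by unfold SmirnovTight at h20; omega) Sz hr
    (by push_cast; linarith)


/-! ## Cycle 2 — § I. Strassen's equations see the (2,5) rung exactly (kit j013638)

Numerical theorem (no Lean content): `dist(⟨2,2,2⟩, V)² = 2.0000 = d₅²` for the determinantal variety
`V ⊇ σ̂₅` cut out by the `p = 1` Koszul flattenings (all lines, three slots, rank `≤ 10`; full `≤ 15`).
Details in the module docstring (§ I).  Consequence for this file: no tensor that merely passes every
Strassen test gets closer to `T` than Bini's deletion; the `V`-minimisers form a larger family
(`X* = T − D*`, honest rank 6, fidelity 6) on which the bound is also tight. -/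


/-! ## Cycle 2 — § I′. The Strassen route to `SixEighthsAtFive`, stated formally -/

/-- **The Strassen/Koszul route to the (2,5) rung** suggested by § I (numerically TRUE: `dist(T,V)² = 2`,
kit j013638/j013999): every `X ∈ ℂ⁴⊗ℂ⁴⊗ℂ⁴` whose `p = 1` Koszul flattenings (`12 × 12` matrices —
Strassen's commutator test), for EVERY projection `Φ : ℂ⁴ → ℂ³` in EACH of the three slots, have rank
`≤ 10 = 2·5` satisfies `|⟨X,T⟩|² ≤ 6‖X‖²`.  A statement about a determinantal variety (degree-11 minors
of matrices of linear forms) — no secant variety, no rank decomposition inside.  Conjecture (evidence: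
§ I); its minimisers are NOT only Bini's (the Grassmannian family `W₁ + (I−P)W₂` of § I is tight too). -/
def StrassenMetricTwoFive : Prop :=
  ∀ X : P2 → P2 → P2 → ℂ,
    (∀ Φ : (P2 → ℂ) →ₗ[ℂ] (Fin (2 * 1 + 1) → ℂ), (koszulFlattening 1 Φ X).rank ≤ 10) →
    (∀ Φ : (P2 → ℂ) →ₗ[ℂ] (Fin (2 * 1 + 1) → ℂ), (koszulFlattening 1 Φ (rotate X)).rank ≤ 10) →
    (∀ Φ : (P2 → ℂ) →ₗ[ℂ] (Fin (2 * 1 + 1) → ℂ),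
      (koszulFlattening 1 Φ (rotate (rotate X))).rank ≤ 10) →
    ‖∑ a, ∑ b, ∑ c, X a b c * matMulTensor ℂ 2 2 2 a b c‖ ^ 2 ≤ 6 * ∑ a, ∑ b, ∑ c, ‖X a b c‖ ^ 2

/-- `StrassenMetricTwoFive → SixEighthsAtFive`: a rank-`≤ 5` tensor passes every Strassen test
(Landsberg–Ottaviani, tree theorem `LandsbergOttaviani2015_rank_koszulFlattening_le`:
`rank K_Φ(X) ≤ C(2,1)·R(X) = 2·R(X)`; slots rotated with `tensorRank_rotate`).  So the (2,5) rung —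
and with it the `n = 2` content of the crux besides `SevenEighthsLaw` — reduces to a metric statement on
Strassen's determinantal variety. -/
theorem sixEighthsAtFive_of_strassenMetricTwoFive (h : StrassenMetricTwoFive) : SixEighthsAtFive := by
  intro S hS
  have key : ∀ Y : P2 → P2 → P2 → ℂ, tensorRank Y ≤ 5 →
      ∀ Φ : (P2 → ℂ) →ₗ[ℂ] (Fin (2 * 1 + 1) → ℂ), (koszulFlattening 1 Φ Y).rank ≤ 10 := by
    intro Y hY Φ
    have h1 := LandsbergOttaviani2015_rank_koszulFlattening_le 1 Φ Y
    have h2 : (2 * 1).choose 1 = 2 := by decide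
    rw [h2] at h1
    omega
  exact h S (key S hS) (key (rotate S) (by rw [tensorRank_rotate]; exact hS))
    (key (rotate (rotate S)) (by rw [tensorRank_rotate, tensorRank_rotate]; exact hS))

/-! ## Cycle 2 — § J. Order-`h` border charts at (2,5) (kit j013812 → j014350)

The attack surface left open by cycle 1 ("`h ≥ 2` border schemes near `M^red`").  Chart of order `h`:
`S = [εʰ] Σ_{l<5} A_l(ε)⊗B_l(ε)⊗C_l(ε)`, `A_l = Σ_{d≤h} a_l^{(d)} ε^d`, subject to `[ε^m] = 0 (m < h)`;
every such `S` lies in `σ̂₅`, Bini is the `h = 1` point `S = M^red`.  Findings (j014350; the first attempt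
j013812 used a penalty continuation that left feasibility and is void):
* Bini's chart point is CRITICAL for the fidelity in every chart tested: projected gradient `0` for
  `h = 1, 2, 3`; the constraint Jacobians there have rank `52/128`, `86/256`, `126/384` — the chart
  varieties are very singular at Bini (Gauss–Newton projection of a `10⁻³`-perturbation lands at fidelity
  `0.5–1.2`, i.e. far away), which is WHY naive second-order tests there are delicate.
* Riemannian ascent (tangent projection + Gauss–Newton retraction, 300 steps) from 37 Bini-perturbed and
  18 random feasible chart points, `h = 1, 2, 3`: best fidelities `5.944 (h=1)`, `5.944 (h=2)`,
  `5.930 (h=3)`, all climbing towards `6` from below; honest re-evaluation of the rank-5 tensors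
  `Σ_l A_l(ε)B_l(ε)C_l(ε)/εʰ` at `ε = 10⁻¹…10⁻³` agrees to `10⁻³`; NO value above `6` (0 alerts).
* Honest (`h = 0`) ascent: 22 random starts → `≤ 5.99942`; 10 starts from ALS fits of the DIAGONAL
  deletion (§ M′, fidelity `5.99939` at start) creep to `5.99942` in 400 steps — the second tight orbit
  is approached from below exactly like Bini's.
So on every stratum reached the supremum is `6⁻`; combined with cycle 1 (2-jet at `M^red`, `Φ ≤ 6` on
all `h = 1` limits) and § I (even the Strassen relaxation `V ⊋ σ̂₅` stays at distance `2`), the (2,5)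
rung has no remaining numerically accessible attack surface. -/

/-! ## Cycle 2 — § K. Families that can never test the law (paper; module docstring § K)

Deletions (tight, never violating) and abelian Cohn–Umans pull-backs with collisions
(`|G| + d² ≥ n³` by Cauchy–Schwarz on `Σ_g m(g)²`).  Recorded as prose; the formal content would be a
statement about 0/1 tensors containing `T` whose rank certificate is a character table. -/

/-! ## Cycle 2 — § L. The `n = 3` window: deletion border ranks and the "21-staircase" (kit j013639, j014363)

ALS with Tikhonov continuation (580 + 181 runs; seeds: Smirnov's `⟨3,3,3;20⟩` scheme from the tree file
with one/two/three terms dropped at `x ∈ {0.15,…,0.4}`, Laderman minus its five unit products, random):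
* `R̲(⟨3,3,3⟩ − e)` — THE FIRST DELETION IS FREE (kit j014532): seeded FROM Smirnov's 20-term scheme,
  ALS adapts it to `⟨3,3,3⟩ − e` at rank 20 for 26 of the 27 products `e` (errors `1.3·10⁻³ … 0.14 ↘`
  with factor growth — below the `0.092` to which the SAME ALS lets the exact scheme for `⟨3,3,3⟩` itself
  drift), i.e. numerically `R̲(⟨3,3,3⟩ − e) ≤ 20 = R̲(⟨3,3,3⟩)`; at rank 19 the Smirnov-drop-one seeds
  floor at `1.02` for `⟨3,3,3⟩ − e` (5 products tested) — no sign of `19`.  So the `n = 2` pattern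
  "`R̲(T − e) = R̲(T) − 1`" (one deletion buys one border multiplication) FAILS at `n = 3`: the deletion
  buys nothing, and the step `20 → 19` costs `d₁₉ ≈ 2`, twice the law's unit.  Calibration, essential
  in this window: random-start ALS for `⟨3,3,3⟩` at rank 20 floors at `2, 3, 4` (the Tichavský–Phan–
  Cichocki phenomenon) and Laderman/random seeds for `⟨3,3,3⟩ − e` give only the trivial `R̲ ≤ 21`
  (rank-21 error `↘ 0`, kit j013639) — unseeded numbers mean nothing here.
* nearest points of `⟨3,3,3⟩` (upper bounds, all border-type = still slowly decreasing):
  `d₁₉ ≤ 2.0123` (drop Smirnov's term 16), `d₁₈ ≤ 3.0210` (drop terms 8,19), `d₁₇ ≤ 5.0007`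
  (drop 16,17,7), `d₁₆ ≤ 6.03` (triage k1); i.e. the staircase `d_r ≈ 21 − r` for `r = 18, 19` and
  `d₂₀ = 0`: `r + d_r ≥ 21.01` everywhere, the law modulo `SmirnovTight` needs `≥ 20` — slack `1.0` at
  `r = 18, 19` (was `1.33` before this cycle).  Two/three-deletions: `⟨3,3,3⟩ − e − e′` at rank 19 has
  error `→ 2` (share an index) / `→ 1` (disjoint), at rank 18 `→ 3`; `⟨3,3,3⟩ − 3e` (Laderman's units):
  rank 19 `→ 1`, 18 `→ 2`, 17 `→ 3` — some 4-deletions of `⟨3,3,3⟩` have border rank `≤ 19` numerically.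
* Reading: under the law every such point is an UPPER bound `R̲(⟨3,3,3⟩) ≤ r + d_r`; nothing found
  below `21.01`, so the law is consistent with — and would be tight only at — `R̲ = 20` via Smirnov's
  isolated scheme.  A point with `r + d_r < 20` would be news either way (`¬law ∨ R̲(⟨3,3,3⟩) ≤ 19`);
  an LM-polished sweep over all 20 Smirnov drop-one (rank 19: best `2.007`, term 16; most others `3.000`)
  and all 190 drop-two seeds (rank 18) is kit j014518 (results attach to the item).

## Cycle 2 — § M. The (2,5) isotope pencil is FLAT (kit j014009)

`T_u = T + (u−1)·e` (one unit product reweighted): `d₅(u) := dist(T_u, σ̂₅)² = min(1 + |u|², 2)` to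
`2·10⁻⁴` for all 15 values tested (`u ∈ {0, ¼, ½, ¾, 0.9, 1, 1.1, 1¼, 1½, 2, 3, −½, −1, i, e^{iπ/3}}`):
deletions are optimal along the whole pencil (`|u| < 1`: delete the `u`-product and a partner sharing a
variable; `|u| ≥ 1`: a Bini pair avoiding it), so `M₅(T_u) = ‖T_u‖² − 2 = 6` on the entire circle
`|u| = 1` — the (2,5) bound `6` is NOT special to `u = 1` (contrast: at `r = 6` the sister seat found
`M₆(T_{−1}) ≥ 7.0386 > 7`, `Cruxes/SevenEighthsLaw/Disproof.lean` § (g)).  For provers: a certificate of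
`SixEighthsAtFive` may (and the Strassen route of § I would) prove the whole pencil at once. -/


/-! ## Cycle 2 — § M′. The second tight orbit at (2,5): the DIAGONAL 2-deletion (kit j014009) -/

/-- The diagonal 2-deletion `⟨2,2,2⟩ − a₁₁b₁₁c₁₁ − a₂₂b₂₂c₂₂` (the six products `a_ij b_jk c_ki` with
`(i,j,k)` not constant), as an integer tensor in the tree's slot order `(Z, X, Y)`.  Numerically of border
rank `5` (kit j014009: rank-5 ALS error `3.3·10⁻⁴ ↘ 0`, factor growth — the border signature, like
`M^red`), while the "share-one-index" 2-deletions stay at distance² `0.75` from `σ̂₅`.  Its `A`-marginal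
has rank 2, Bini's `E` has `A`-rank 1, so the two tight points lie in different orbits of the isotropy
group: the maximiser set of the (2,5) rung has (at least) TWO `K`-orbits.  Its exact 5-term scheme is
OPEN: a least-squares search for order-1 schemes (kit j014449) reaches `10⁻²⁹` for the control `M^red`
(Bini exists) but plateaus at `3·10⁻¹⁰` for this tensor in 30 tries (order-2 tries at `10⁻¹²…10⁻¹⁰`) — it
may be a border point of order `≥ 2`; and no `GL₂³`-transport of Bini's base 5-configuration with GRADED
first-order legs can work (grading by the number of diagonal legs: every product here has exactly one;
the three span conditions force two dependent rows of `g₂⁻¹` — folder NOTES.md). -/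
def diagDelZ : P2 → P2 → P2 → ℤ := fun a b c =>
  if (a = (0, 0) ∧ b = (0, 0) ∧ c = (0, 0)) ∨ (a = (1, 1) ∧ b = (1, 1) ∧ c = (1, 1)) then 0
  else matMulTensor ℤ 2 2 2 a b c

/-- `⟨T_diag, T⟩ = ‖T_diag‖² = 6`: fidelity exactly `6 = 5 + 1`, the (2,5) bound, at the second orbit. -/
theorem diagDelZ_vals : overlapZ diagDelZ = 6 ∧ normSqZ diagDelZ = 6 := by decide

end Summit.MatrixMultiplication.MatrixMultiplication.Cruxes.LinearDefectLaw.Disproof
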